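import Summits.RiemannHypothesis.RiemannHypothesis.Theorems.SoninBandEnergyBound
import Literature.Analysis.FunctionSpaces.PlancherelL1L2
import HarnessLib

/-!
# Band energy of time-limited functions, VII: the `L²`-class form (for the Sonin-space distance lemma)

Cell `rh-explicit`, seat cc-s2-3 (`HOME/cc-s2-3/CERT-PLAN.md` §7, E1 → E2 hand-off).  The tree's Sonin space
`soninSpace 1 1` (Connes–Consani 2021 §4) is a subspace of `Lp ℂ 2 volume` cut out by `ξ = 0` a.e. on `[−1,1]` and
`𝓕 ξ = 0` a.e. on `[−1,1]` with Mathlib's `L²` Fourier transform `𝓕 : Lp ℂ 2 → Lp ℂ 2`.  This file restates the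
band-energy bound of file VI (`integral_norm_sq_fourier_Icc_le`, stated with the Fourier INTEGRAL of a function) for
`L²` CLASSES and the `L²` transform: for every `F ∈ L²(ℝ)` vanishing a.e. off `[−1,1]`,
`∫_{[−1,1]} ‖(𝓕 F)(ξ)‖² dξ ≤ 0.9999428 · ‖F‖²` (`integral_norm_sq_lpFourier_Icc_le`) — i.e. `‖P̂ P‖² ≤ 0.9999428`
for the two projections `P` (time-limiting) and `P̂` (band-limiting), the input of the Neumann-series distance lemma
`dist(η, S(1,1)) ≤ ‖P̂η‖/(1 − 0.9999428)` (E2, seat cc-s2-1).  The bridge is the tree's `L¹ ∩ L²` consistency lemma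
`Literature.Analysis.FunctionSpaces.fourier_toLp_ae_eq_fourierIntegral`.  Proof-only; no facts, no axioms.
-/

set_option linter.dupNamespace false  -- the mandated namespace repeats `RiemannHypothesis`

noncomputable section

open MeasureTheory Complex Set
open scoped Real FourierTransform
open Literature.Analysis.FunctionSpaces (fourier_toLp_ae_eq_fourierIntegral)

namespace Summit.RiemannHypothesis.RiemannHypothesis.BandEnergy

/-- An `L²` class vanishing a.e. off `[−1,1]` has an integrable representative. [folklore] -/
theorem integrable_coeLp_of_ae_eq_zero_off_Icc (F : Lp ℂ 2 (volume : Measure ℝ))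
    (hF : ∀ᵐ x : ℝ, x ∉ Icc (-1 : ℝ) 1 → (F : ℝ → ℂ) x = 0) : Integrable (F : ℝ → ℂ) := by
  have h2 : MemLp (F : ℝ → ℂ) 2 ((volume : Measure ℝ).restrict (Icc (-1 : ℝ) 1)) := (Lp.memLp F).restrict _
  have hi : IntegrableOn (F : ℝ → ℂ) (Icc (-1 : ℝ) 1) := h2.integrable one_le_two
  exact hi.integrable_of_ae_notMem_eq_zero hF

/-- **Band energy, `L²`-class form**: for `F ∈ L²(ℝ)` with `F = 0` a.e. off `[−1,1]`, the `L²` Fourier transform satisfies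
`∫_{[−1,1]} ‖(𝓕 F) ξ‖² dξ ≤ 0.9999428 · ‖F‖²`. [folklore] -/
theorem integral_norm_sq_lpFourier_Icc_le (F : Lp ℂ 2 (volume : Measure ℝ))
    (hF : ∀ᵐ x : ℝ, x ∉ Icc (-1 : ℝ) 1 → (F : ℝ → ℂ) x = 0) :
    ∫ ξ in Icc (-1 : ℝ) 1, ‖((𝓕 F : Lp ℂ 2 (volume : Measure ℝ)) : ℝ → ℂ) ξ‖ ^ 2
      ≤ (9999428 / 10000000 : ℝ) * ‖F‖ ^ 2 := by
  have h2 : MemLp (F : ℝ → ℂ) 2 (volume : Measure ℝ) := Lp.memLp F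
  have h1 : Integrable (F : ℝ → ℂ) := integrable_coeLp_of_ae_eq_zero_off_Icc F hF
  have hae := fourier_toLp_ae_eq_fourierIntegral h1 h2
  rw [Lp.toLp_coeFn F h2] at hae
  have hI : ∫ ξ in Icc (-1 : ℝ) 1, ‖((𝓕 F : Lp ℂ 2 (volume : Measure ℝ)) : ℝ → ℂ) ξ‖ ^ 2
      = ∫ ξ in Icc (-1 : ℝ) 1, ‖𝓕 (F : ℝ → ℂ) ξ‖ ^ 2 :=
    integral_congr_ae (ae_restrict_of_ae (hae.mono fun ξ hξ => by simp only [hξ]))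
  have hN : ‖F‖ ^ 2 = ∫ x, ‖(F : ℝ → ℂ) x‖ ^ 2 := by
    rw [← norm_toLp_sq h2, Lp.toLp_coeFn F h2]
  rw [hI, hN]
  exact integral_norm_sq_fourier_Icc_le h2 hF

/-- The complementary form: `(1 − 0.9999428)‖F‖² ≤ ‖F‖² − ∫_{[−1,1]} ‖𝓕 F‖²` — the "`1 − λ₀ ≥ 5.72·10⁻⁵`" inequality for
`L²` classes supported in `[−1,1]`. [folklore] -/
theorem sub_integral_norm_sq_lpFourier_Icc_ge (F : Lp ℂ 2 (volume : Measure ℝ))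
    (hF : ∀ᵐ x : ℝ, x ∉ Icc (-1 : ℝ) 1 → (F : ℝ → ℂ) x = 0) :
    (143 / 2500000 : ℝ) * ‖F‖ ^ 2
      ≤ ‖F‖ ^ 2 - ∫ ξ in Icc (-1 : ℝ) 1, ‖((𝓕 F : Lp ℂ 2 (volume : Measure ℝ)) : ℝ → ℂ) ξ‖ ^ 2 := by
  have h := integral_norm_sq_lpFourier_Icc_le F hF
  nlinarith [sq_nonneg ‖F‖]

end Summit.RiemannHypothesis.RiemannHypothesis.BandEnergy
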